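import Summits.BirchSwinnertonDyer.Rank1Residual.P2.KrizLiSmallCMBaseTransport
import HarnessLib

/-!
# Cell `bsd-print-cf2` (D-0131 (2) PRINT TIER, leaf CornerF @ `p = 2`), prover p3 — the generic Kriz–Li
# family BY NAME: membership predicate (base, Heegner field, (★)-datum, `d` inside an `∃`) and the slice in
# the binder shapes of the leaf and of crux `InertJZeroOfFacts`; the printed `243a1` fibre

HONEST FRAMING. Companion of `P2/KrizLiSmallCMBaseTransport.lean` (the transport, base-generic and
field-generic; see its docstring for what is and is not reached). The leaf
`Summit.BirchSwinnertonDyer.WAllCornerFTwo` and crux `InertJZeroOfFacts` (stmt-20671) are OPEN AS CLASSES;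
nothing class-wide is closed here; no named fact is introduced; nothing is asserted. This file packages the
hypotheses of the transport into ONE membership predicate `IsIsogenousToKrizLiTwistOfSmallCMBase W'`
(a definition with a body: `∃` base `W` — globally minimal, CM, `N(W) < 5000`, a rational point of infinite
order, `E(ℚ)[2] = 0`, `c₂` odd —, `∃` imaginary quadratic `K` with the Heegner hypothesis, `∃` parametrisation
datum / Heegner datum / embedding / Heegner point / `j : K → ℚ₂` with Kriz–Li's Assumption (★) and the
Manin clause, `∃ d ∈ 𝒩(W, K)` with `χ_d(−N) = 1`, and a `ℚ`-isogeny `W' ~ W^{(d)}` or `W' ~ W^{(d·d_K)}`),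
and proves `BSD(W', 2)` for every globally minimal member BY NAME from seven facts — `hKL hBF hmod hGZK
hCassels` (conjuncts of 𝔅_inert), `h33` (aside 20767), `hS31` (aside 20768) — with NO table fact: the
(★)-datum travels inside the membership (for `243a1` it is the printed Table-1 row, §4; for the other
certified bases of lit DOSSIER §14.4/§14.6 it is a certificate the member must exhibit — currency
LITERAL-by-name((★)-display) for those). Beyond print: NO as a method; coverage only.

References: [KrizLi2019] Thm 5.1 (2), Thm 4.3, Def 4.1, §6 Ex. 6.2, Table 1, Rem 6.3; [CreutzMiller2012]
Thm 1.1; [BurungaleFlach2024] Thm 1.1, Cor 2; [MilneADT2006] I.7.3; tree `P2/KrizLiTwoFortyThree*` (p3 g2).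
-/

noncomputable section

open scoped Classical

open WeierstrassCurve NumberField Literature.NumberTheory.EllipticCurves
  Literature.NumberTheory.EllipticCurves.Rank1Residual
  Literature.NumberTheory.EllipticCurves.ModularForms
  Summit.BirchSwinnertonDyer.Rank1Residual

set_option autoImplicit false

namespace Summit.BirchSwinnertonDyer.Rank1Residual.P2

/-! ## §3 The (★)-datum as ONE predicate, the membership predicate, and the slice BY NAME -/

/-- **`(W, K)` carries a Kriz–Li (★)-datum**: a modular parametrisation datum `Dt` of `W` at level
`N(W)` (junk-free: its fields pin the newform, the Néron lattice and `Dt.c = ±c_E`), a Heegner datum `H`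
of level `N(W)` and discriminant `d_K`, an embedding `ι : K → ℂ`, the Heegner point `P ∈ W(K)`
(`P ↦ heegnerPointComplex Dt H`) and `j : K → ℚ₂` with Kriz–Li's Assumption (★) (which contains "`2`
splits in `K`"), together with the Manin clause of Thm 5.1 ("`c_E` odd if `E` is additive at `2`",
vacuous for a base with good or multiplicative reduction at `2`). A PREDICATE with parameters `(W, K)`
(a definition with a body, not a named fact): for `(243a1, K)` with `d_K = −23` it is supplied by the
PRINTED Table-1 row (`hasKrizLiStarDatum_curve243a1`); for any other pair it is a CERTIFICATE the user
displays (lit DOSSIER §14.4/§14.6: `heegner_index` + `2`-adic formal logarithm).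
[cite: KrizLi2019, Assumption (★) (FMS Thm. 1.12 / §4), Thm. 5.1 hypotheses, §6 Ex. 6.1–6.2] -/
def HasKrizLiStarDatum (W : WeierstrassCurve ℚ) [W.IsElliptic] [W.IsGloballyMinimal]
    [NeZero (W.conductorNorm ℤ)] (K : Type) [Field K] [NumberField K] : Prop :=
  ∃ (Dt : ModularParametrizationData W (W.conductorNorm ℤ))
    (H : HeegnerDatum (W.conductorNorm ℤ) (NumberField.discr K)) (ι : K →+* ℂ)
    (P : (W.baseChange K).toAffine.Point) (j : K →ₐ[ℚ] ℚ_[2]),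
    WeierstrassCurve.Affine.Point.map ι.toRatAlgHom P = heegnerPointComplex Dt H ∧
    KrizLi2019.AssumptionStar W Dt K P j ∧
    (haveI : Fact (2 : ℕ).Prime := ⟨Nat.prime_two⟩;
      ¬ W.HasGoodReductionAtPrime 2 → ¬ W.HasMultiplicativeReductionAtPrime 2 → Odd Dt.c)

section StarDatum

variable (W : WeierstrassCurve ℚ) [W.IsElliptic] [W.IsGloballyMinimal] [NeZero (W.conductorNorm ℤ)]

/-- **`ord_{s=1} L(W, s) = 1`** for a CM base with a rational point of infinite order, `E(ℚ)[2] = 0` and a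
(★)-datum over a Heegner field (packaged form of `analyticRank_eq_one_of_assumptionStar`).
[cite: KrizLi2019, Thm. 4.3 (FMS)] [cite: BurungaleFlach2024, Cor. 2] -/
theorem analyticRank_eq_one_of_hasKrizLiStarDatum (h33 : KrizLi2019.thm33_rank_twist)
    (hBF : bsdTriple_of_hasCM_of_L_one_ne_zero) (hmod : hasEntireLFunction_rat)
    (hcm : W.HasCM) (hrk : 1 ≤ W.mordellWeilRank) (h2 : ∀ Q : W.toAffine.Point, 2 • Q = 0 → Q = 0)
    (K : Type) [Field K] [NumberField K] (hK : IsImaginaryQuadratic K)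
    (hH : SatisfiesHeegnerHypothesis (W.conductorNorm ℤ) K) (hSD : HasKrizLiStarDatum W K) :
    W.analyticRank = 1 := by
  obtain ⟨Dt, H, ι, P, j, hP, hstar, -⟩ := hSD
  exact analyticRank_eq_one_of_assumptionStar W h33 hBF hmod hcm hrk h2 K hK hH Dt H ι P hP j hstar

/-- **The analytic ranks along the family** (packaged form): `r_an = 1` on the models of `W^{(d)}`,
`r_an = 0` on the models of `W^{(d·d_K)}`, for `d ∈ 𝒩(W, K)` with `χ_d(−N) = 1`.
[cite: KrizLi2019, Thm. 4.3 (FMS) = arXiv Thm. 3.3] -/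
theorem analyticRank_of_twist_of_hasKrizLiStarDatum (h33 : KrizLi2019.thm33_rank_twist)
    (hBF : bsdTriple_of_hasCM_of_L_one_ne_zero) (hmod : hasEntireLFunction_rat)
    (hcm : W.HasCM) (hrk : 1 ≤ W.mordellWeilRank) (h2 : ∀ Q : W.toAffine.Point, 2 • Q = 0 → Q = 0)
    (K : Type) [Field K] [NumberField K] (hK : IsImaginaryQuadratic K)
    (hH : SatisfiesHeegnerHypothesis (W.conductorNorm ℤ) K) (hSD : HasKrizLiStarDatum W K)
    {d : ℤ} (hd : KrizLi2019.InN W K d) (hsign : Int.sign d * jacobiSym (W.conductorNorm ℤ) d.natAbs = 1)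
    (W₁ W₂ : WeierstrassCurve ℚ) [W₁.IsElliptic] [W₁.IsGloballyMinimal] [W₂.IsElliptic] [W₂.IsGloballyMinimal]
    (hW₁ : ∃ C : VariableChange ℚ, C • W.quadraticTwist (d : ℚ) = W₁)
    (hW₂ : ∃ C : VariableChange ℚ, C • W.quadraticTwist ((d * NumberField.discr K : ℤ) : ℚ) = W₂) :
    W₁.analyticRank = 1 ∧ W₂.analyticRank = 0 := by
  obtain ⟨Dt, H, ι, P, j, hP, hstar, -⟩ := hSD
  exact analyticRank_of_twist_of_krizLi_cmBase W h33 hBF hmod hcm hrk h2 K hK hH Dt H ι P hP j hstar hd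
    hsign W₁ W₂ hW₁ hW₂

/-- **THE TRANSPORT, packaged**: `BSD(W', 2)` for every globally minimal `W'` `ℚ`-isogenous to `W^{(d)}` or
`W^{(d·d_K)}`, from a CM base `W` with `N(W) < 5000`, a rational point of infinite order, `E(ℚ)[2] = 0`,
`c₂(W)` odd, a Heegner field `K` with a (★)-datum, `d ∈ 𝒩(W, K)`, `χ_d(−N) = 1` — granted the seven named
facts. [cite: KrizLi2019, Thm. 5.1 (2) and Thm. 4.3] [cite: CreutzMiller2012, Thm. 1.1]
[cite: BurungaleFlach2024, Thm. 1.1 and Cor. 2] [cite: MilneADT2006, Thm. I.7.3] -/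
theorem bsdp_two_of_isIsogenous_twist_of_hasKrizLiStarDatum (hKL : KrizLi2019.thm112_bsdTwo_twist)
    (h33 : KrizLi2019.thm33_rank_twist) (hS31 : bsdTriple_of_analyticRank_le_one_of_conductor_lt)
    (hBF : bsdTriple_of_hasCM_of_L_one_ne_zero) (hmod : hasEntireLFunction_rat)
    (hGZK : rank_eq_analyticRank_of_analyticRank_le_one) (hCassels : bsdRHS_eq_of_isIsogenous)
    (hcm : W.HasCM) (hN : W.conductorNorm ℤ < 5000) (hrk : 1 ≤ W.mordellWeilRank)
    (h2 : ∀ Q : W.toAffine.Point, 2 • Q = 0 → Q = 0)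
    (hc2 : haveI : Fact (2 : ℕ).Prime := ⟨Nat.prime_two⟩; Odd ((W.baseChange ℚ_[2]).localTamagawaNumber ℤ_[2]))
    (K : Type) [Field K] [NumberField K] (hK : IsImaginaryQuadratic K)
    (hH : SatisfiesHeegnerHypothesis (W.conductorNorm ℤ) K) (hSD : HasKrizLiStarDatum W K)
    {d : ℤ} (hd : KrizLi2019.InN W K d) (hsign : Int.sign d * jacobiSym (W.conductorNorm ℤ) d.natAbs = 1)
    (W' : WeierstrassCurve ℚ) [W'.IsElliptic] [W'.IsGloballyMinimal]
    (hiso : IsIsogenous W' (W.quadraticTwist (d : ℚ)) ∨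
      IsIsogenous W' (W.quadraticTwist ((d * NumberField.discr K : ℤ) : ℚ))) : BSDp W' 2 := by
  obtain ⟨Dt, H, ι, P, j, hP, hstar, hman⟩ := hSD
  exact bsdp_two_of_isIsogenous_twist_of_krizLi_cmBase W hKL h33 hS31 hBF hmod hGZK hCassels hcm hN hrk h2 K
    hK hH Dt H ι P hP j hstar ⟨hc2, hman⟩ hd hsign W' hiso

end StarDatum

/-- **`W'` is `ℚ`-ISOGENOUS to a Kriz–Li twist of a SMALL-CONDUCTOR CM BASE with a (★)-datum.** There are:
a globally minimal CM base `W` with `N(W) < 5000`, a rational point of infinite order, `E(ℚ)[2] = 0` and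
`c₂(W)` odd; an imaginary quadratic field `K` with the Heegner hypothesis for `N(W)` and a (★)-datum
(`HasKrizLiStarDatum W K`); and `d ∈ 𝒩(W, K)` (Def 4.1) with `χ_d(−N) = 1`, such that `W'` is
`ℚ`-isogenous to `W^{(d)}` or to `W^{(d·d_K)}`. For the base `243a1` and `K = ℚ(√−23)` the (★)-datum is
the PRINTED Table-1 row (§4); for any other base it is a certificate supplied by the member. A definition
with a body (data), not a named fact. [cite: KrizLi2019, Def. 4.1, Thm. 5.1 (2), §6 Ex. 6.2 and Table 1] -/
def IsIsogenousToKrizLiTwistOfSmallCMBase (W' : WeierstrassCurve ℚ) : Prop :=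
  ∃ (W : WeierstrassCurve ℚ) (_ : W.IsElliptic) (_ : W.IsGloballyMinimal) (_ : NeZero (W.conductorNorm ℤ)),
    W.HasCM ∧ W.conductorNorm ℤ < 5000 ∧ 1 ≤ W.mordellWeilRank ∧
    (∀ Q : W.toAffine.Point, 2 • Q = 0 → Q = 0) ∧
    (haveI : Fact (2 : ℕ).Prime := ⟨Nat.prime_two⟩; Odd ((W.baseChange ℚ_[2]).localTamagawaNumber ℤ_[2])) ∧
    ∃ (K : Type) (_ : Field K) (_ : NumberField K), IsImaginaryQuadratic K ∧
      SatisfiesHeegnerHypothesis (W.conductorNorm ℤ) K ∧ HasKrizLiStarDatum W K ∧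
      ∃ d : ℤ, KrizLi2019.InN W K d ∧ Int.sign d * jacobiSym (W.conductorNorm ℤ) d.natAbs = 1 ∧
        (IsIsogenous W' (W.quadraticTwist (d : ℚ)) ∨
          IsIsogenous W' (W.quadraticTwist ((d * NumberField.discr K : ℤ) : ℚ)))

/-- **`BSD(W', 2)` on the whole generic family, ENTIRELY BY NAME** (seven binders: `hKL hBF hmod hGZK
hCassels` ∈ 𝔅_inert, `h33` = aside 20767, `hS31` = aside 20768; NO table fact — the (★)-datum travels inside
the membership). [cite: KrizLi2019, Thm. 5.1 (2), Thm. 4.3] [cite: CreutzMiller2012, Thm. 1.1]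
[cite: BurungaleFlach2024, Thm. 1.1 and Cor. 2] [cite: MilneADT2006, Thm. I.7.3] -/
theorem bsdp_two_of_isIsogenousToKrizLiTwistOfSmallCMBase (hKL : KrizLi2019.thm112_bsdTwo_twist)
    (h33 : KrizLi2019.thm33_rank_twist) (hS31 : bsdTriple_of_analyticRank_le_one_of_conductor_lt)
    (hBF : bsdTriple_of_hasCM_of_L_one_ne_zero) (hmod : hasEntireLFunction_rat)
    (hGZK : rank_eq_analyticRank_of_analyticRank_le_one) (hCassels : bsdRHS_eq_of_isIsogenous)
    (W' : WeierstrassCurve ℚ) [W'.IsElliptic] [W'.IsGloballyMinimal]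
    (hW' : IsIsogenousToKrizLiTwistOfSmallCMBase W') : BSDp W' 2 := by
  obtain ⟨W, _, _, _, hcm, hN, hrk, h2, hc2, K, _, _, hK, hH, hSD, d, hd, hsign, hiso⟩ := hW'
  exact bsdp_two_of_isIsogenous_twist_of_hasKrizLiStarDatum W hKL h33 hS31 hBF hmod hGZK hCassels hcm hN hrk
    h2 hc2 K hK hH hSD hd hsign W' hiso

/-- **Every member has CM** (unconditional). [cite: SilvermanAEC2009, Cor. III.9.4 and X.5.4] -/
theorem hasCM_of_isIsogenousToKrizLiTwistOfSmallCMBase (W' : WeierstrassCurve ℚ) [W'.IsElliptic]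
    (hW' : IsIsogenousToKrizLiTwistOfSmallCMBase W') : W'.HasCM := by
  obtain ⟨W, _, _, _, hcm, -, -, -, -, K, _, _, -, -, -, d, hd, -, hiso⟩ := hW'
  have hD : (NumberField.discr K : ℚ) ≠ 0 := by exact_mod_cast NumberField.discr_ne_zero K
  have hd0 : (d : ℚ) ≠ 0 := cast_ne_zero_of_inN W hd
  rcases hiso with hiso | hiso
  · exact hasCM_of_isIsogenous_twist_of_hasCM W hcm hd0 W' hiso
  · exact hasCM_of_isIsogenous_twist_of_hasCM W hcm (by push_cast; exact mul_ne_zero hd0 hD) W' hiso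

/-- **SLICE BY NAME in LEAF SHAPE** (`Summit.BirchSwinnertonDyer.WAllCornerFTwo` / crux `InertTwoRankOneOfFacts`:
`∀ W, W.HasCM → W.analyticRank = 1 → CMInert W 2 → … → BSDp W 2`; the three class hypotheses are not used):
every globally minimal curve `ℚ`-isogenous to a Kriz–Li twist of a small-conductor CM base with a
(★)-datum satisfies `BSD(W, 2)`, granted the seven named facts. Beyond print: NO as a method; as coverage,
every (★)-certificate at a CM base of conductor `< 5000` (lit DOSSIER §14.4/§14.6) closes its family here.
[cite: KrizLi2019, Thm. 5.1 (2), Thm. 4.3, §6 Ex. 6.2, Table 1, Rem. 6.3] [cite: CreutzMiller2012, Thm. 1.1]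
[cite: BurungaleFlach2024, Thm. 1.1 and Cor. 2] [cite: MilneADT2006, Thm. I.7.3] -/
theorem cornerFTwo_krizLiSmallCMBase_byName (hKL : KrizLi2019.thm112_bsdTwo_twist)
    (h33 : KrizLi2019.thm33_rank_twist) (hS31 : bsdTriple_of_analyticRank_le_one_of_conductor_lt)
    (hBF : bsdTriple_of_hasCM_of_L_one_ne_zero) (hmod : hasEntireLFunction_rat)
    (hGZK : rank_eq_analyticRank_of_analyticRank_le_one) (hCassels : bsdRHS_eq_of_isIsogenous) :
    ∀ (W' : WeierstrassCurve ℚ) [W'.IsElliptic] [W'.IsGloballyMinimal], W'.HasCM → W'.analyticRank = 1 →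
      CMInert W' 2 → IsIsogenousToKrizLiTwistOfSmallCMBase W' → BSDp W' 2 :=
  fun W' _ _ _ _ _ hW' =>
    bsdp_two_of_isIsogenousToKrizLiTwistOfSmallCMBase hKL h33 hS31 hBF hmod hGZK hCassels W' hW'

/-- **SLICE BY NAME in the binder shape of crux `InertJZeroOfFacts` (stmt-20671)** (`∀ W, W.analyticRank = 1 →
W.j = 0 → … → BSDp W 2`; the two class hypotheses are not used). [cite: KrizLi2019, Thm. 5.1 (2), Thm. 4.3] -/
theorem jZero_krizLiSmallCMBase_byName (hKL : KrizLi2019.thm112_bsdTwo_twist)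
    (h33 : KrizLi2019.thm33_rank_twist) (hS31 : bsdTriple_of_analyticRank_le_one_of_conductor_lt)
    (hBF : bsdTriple_of_hasCM_of_L_one_ne_zero) (hmod : hasEntireLFunction_rat)
    (hGZK : rank_eq_analyticRank_of_analyticRank_le_one) (hCassels : bsdRHS_eq_of_isIsogenous) :
    ∀ (W' : WeierstrassCurve ℚ) [W'.IsElliptic] [W'.IsGloballyMinimal], W'.analyticRank = 1 → W'.j = 0 →
      IsIsogenousToKrizLiTwistOfSmallCMBase W' → BSDp W' 2 :=
  fun W' _ _ _ _ hW' =>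
    bsdp_two_of_isIsogenousToKrizLiTwistOfSmallCMBase hKL h33 hS31 hBF hmod hGZK hCassels W' hW'

/-! ## §4 The printed instance `(243a1, ℚ(√−23))` is a member -/

/-- **The printed Table-1 row IS a (★)-datum for `(243a1, ℚ(√−23))`** in the sense of `HasKrizLiStarDatum`
(the Manin clause is vacuous: `243a1` has good reduction at `2`). [cite: KrizLi2019, §6 Table 1 (row 243a1) and Rem. 6.3] -/
theorem hasKrizLiStarDatum_curve243a1 (htab : KrizLi2019.table1_row243a1) :
    HasKrizLiStarDatum curve243a1 (sqrtField (-23)) := by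
  obtain ⟨Dt, H, ι, P, j, hP, hstar⟩ := exists_assumptionStar_curve243a1 htab
  exact ⟨Dt, H, ι, P, j, hP, hstar, (krizLi_loc_curve243a1 Dt).2⟩

/-- **The Kriz–Li `243a1` classes are members of the generic family, granted the Table-1 row** (`htab`
supplies the (★)-datum over `ℚ(√−23)`; everything else about the base is in the kernel:
`P2/KrizLiTwoFortyThreeCurve.lean`). [cite: KrizLi2019, §6 Table 1 (row 243a1) and Rem. 6.3] -/
theorem isIsogenousToKrizLiTwistOfSmallCMBase_of_twoFortyThree (htab : KrizLi2019.table1_row243a1)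
    {W' : WeierstrassCurve ℚ} (hW' : IsIsogenousToKrizLiTwoFortyThreeTwist W') :
    IsIsogenousToKrizLiTwistOfSmallCMBase W' := by
  haveI : Fact (2 : ℕ).Prime := ⟨Nat.prime_two⟩
  obtain ⟨d, hd, hsign, hiso⟩ := hW'
  obtain ⟨hIQ, hdisc⟩ := isImaginaryQuadratic_and_discr_sqrtField_neg_twentyThree
  have hdK : ((d * NumberField.discr (sqrtField (-23)) : ℤ) : ℚ) = ((-23 * d : ℤ) : ℚ) := by
    rw [hdisc]; push_cast; ring
  refine ⟨curve243a1, inferInstance, inferInstance, inferInstance, hasCM_curve243a1,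
    lt_of_le_of_lt (Nat.le_of_dvd (by norm_num) conductorNorm_curve243a1_dvd) (by norm_num),
    one_le_mordellWeilRank_curve243a1, twoTorsion_curve243a1,
    (by rw [localTamagawaNumber_two_curve243a1]; exact odd_one), sqrtField (-23),
    inferInstance, inferInstance, hIQ, satisfiesHeegnerHypothesis_curve243a1 hIQ.1 hdisc,
    hasKrizLiStarDatum_curve243a1 htab, d, hd, hsign, ?_⟩
  rw [hdK]
  exact hiso

/-- **The p3 g2 slice is the `243a1` fibre of the generic slice**: granted the Table-1 row, the generic leaf
shape implies the `243a1` leaf shape. [cite: KrizLi2019, §6 Table 1 (row 243a1)] -/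
theorem cornerFTwo_krizLiTwoFortyThree_of_smallCMBase (htab : KrizLi2019.table1_row243a1)
    (h : ∀ (W' : WeierstrassCurve ℚ) [W'.IsElliptic] [W'.IsGloballyMinimal], W'.HasCM → W'.analyticRank = 1 →
      CMInert W' 2 → IsIsogenousToKrizLiTwistOfSmallCMBase W' → BSDp W' 2) :
    ∀ (W' : WeierstrassCurve ℚ) [W'.IsElliptic] [W'.IsGloballyMinimal], W'.HasCM → W'.analyticRank = 1 →
      CMInert W' 2 → IsIsogenousToKrizLiTwoFortyThreeTwist W' → BSDp W' 2 :=
  fun W' _ _ hcm hr hin hW' => h W' hcm hr hin (isIsogenousToKrizLiTwistOfSmallCMBase_of_twoFortyThree htab hW')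

end Summit.BirchSwinnertonDyer.Rank1Residual.P2

end
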